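import Literature.Topology.FourManifolds.RadialDiffeomorph
import HarnessLib

/-!
# Radial profiles for the neck of the toric model of `(S² × ℝ²) # ℂℙ²`

Pure calculus (no manifolds), in the style and on top of `RadialDiffeomorph.lean`, for the neck
presentation of the glued manifold in the proof that Gluck twists dissolve in `ℂℙ²`
(`Literature/Barriers/SmoothPoincare4/GluckTwistsDissolve.lean`). With `ψ = ballProfile` the
tree's ball profile (`ψ ρ = ρ/32` for `ρ ≤ 8`, `ψ ρ = 1 - 4/ρ` for `ρ ≥ 16`, a smooth increasing
bijection `(0, ∞) → (0, 1)` with smooth inverse) we define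

* the **expansion profile** `η̃ t = 1/8 + t/8 + χ t · (7t/8 - 1/8)`, `χ t = smoothTransition
  (2t - 1/2)`: `η̃ t = 1/8 + t/8` for `t ≤ 1/4`, `η̃ t = t` for `t ≥ 3/4`, `η̃' ≥ 1/8`; a smooth
  increasing bijection `(0, ∞) → (1/8, ∞)` with smooth inverse (`expandProfile*`);
* the **expansion** `radialMap η̃ : E ∖ 0 → E ∖ B̄(0, 1/8)` of a real inner product space, the
  identity on `‖z‖ ≥ 3/4` (`neckExpansion*`, `neckExpansionPartialHomeomorph`) — it opens the
  puncture at the blown-up point;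
* the **squeeze profile** `h s = ψ (4 s) / 8` (`h s = s/64` for `s ≤ 2`, `h → 1/8` at `∞`) and
  the squeeze `z ↦ 8⁻¹ • ballContraction (4 • z) : E → B(0, 1/8)` (`neckSqueeze*`), linear
  (`= 64⁻¹ • z`) on `‖z‖ < 2`, with smooth inverse on the ball — it compresses the neighbourhood
  of the exceptional curve;
* the **neck profile** `γ t = h (-1/t) = ψ (-4/t) / 8` for `t < 0`, `γ t = η̃ t` for `t ≥ 0`:
  since `ψ ρ = 1 - 4/ρ` for `ρ ≥ 16`, `γ t = 1/8 + t/8` on `[-1/4, 1/4]`, so `γ` is a smooth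
  increasing bijection `ℝ → (0, ∞)` with smooth inverse, `γ t = t` for `t ≥ 3/4`, and
  **`γ (-t) = h (1/t)`**, `γ t = η̃ t` for `t > 0` — the two matching conditions of the neck
  recognition principle `Literature.Topology.FourManifolds.isConnectedSum_of_neck` for the expanded
  first summand and the squeezed second summand.

Everything is proved; the constants are fixed once and for all.
-/

noncomputable section

open Set Function Metric Real Filter
open scoped Topology ContDiff

namespace Literature.Topology.FourManifolds

/-! ### §1 The expansion profile -/

section ExpandProfile

/-- The cut-off `χ t = smoothTransition (2t - 1/2)`: `0` for `t ≤ 1/4`, `1` for `t ≥ 3/4`.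
[folklore] -/
def neckCut (t : ℝ) : ℝ := smoothTransition (2 * t - 1 / 2)

/-- `χ t = 0` for `t ≤ 1/4`. [folklore] -/
theorem neckCut_of_le {t : ℝ} (h : t ≤ 1 / 4) : neckCut t = 0 :=
  smoothTransition.zero_of_nonpos (by linarith)

/-- `χ t = 1` for `t ≥ 3/4`. [folklore] -/
theorem neckCut_of_ge {t : ℝ} (h : 3 / 4 ≤ t) : neckCut t = 1 :=
  smoothTransition.one_of_one_le (by linarith)

/-- `0 ≤ χ`. [folklore] -/
theorem neckCut_nonneg (t : ℝ) : 0 ≤ neckCut t := smoothTransition.nonneg _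

/-- `χ ≤ 1`. [folklore] -/
theorem neckCut_le_one (t : ℝ) : neckCut t ≤ 1 := smoothTransition.le_one _

/-- `χ` is monotone. [folklore] -/
theorem neckCut_monotone : Monotone neckCut := fun _ _ hab =>
  smoothTransition.monotone (by linarith)

/-- `χ` is smooth. [folklore] -/
theorem contDiff_neckCut {n : ℕ∞} : ContDiff ℝ n neckCut :=
  smoothTransition.contDiff.comp ((contDiff_const.mul contDiff_id).sub contDiff_const)

/-- `χ` is differentiable. [folklore] -/
theorem differentiable_neckCut : Differentiable ℝ neckCut :=
  (contDiff_neckCut (n := 1)).differentiable one_ne_zero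

/-- `χ' ≥ 0`. [folklore] -/
theorem deriv_neckCut_nonneg (t : ℝ) : 0 ≤ deriv neckCut t :=
  (differentiable_neckCut t).hasDerivAt.nonneg_of_monotone neckCut_monotone

/-- **The expansion profile** `η̃ t = 1/8 + t/8 + χ t · (7t/8 - 1/8)`. [folklore] -/
def expandProfile (t : ℝ) : ℝ := 1 / 8 + t / 8 + neckCut t * (7 * t / 8 - 1 / 8)

/-- `η̃ t = 1/8 + t/8` for `t ≤ 1/4`. [folklore] -/
theorem expandProfile_of_le {t : ℝ} (h : t ≤ 1 / 4) : expandProfile t = 1 / 8 + t / 8 := by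
  rw [expandProfile, neckCut_of_le h]; ring

/-- `η̃ t = t` for `t ≥ 3/4`. [folklore] -/
theorem expandProfile_of_ge {t : ℝ} (h : 3 / 4 ≤ t) : expandProfile t = t := by
  rw [expandProfile, neckCut_of_ge h]; ring

/-- `η̃ 0 = 1/8`. [folklore] -/
theorem expandProfile_zero : expandProfile 0 = 1 / 8 := by
  rw [expandProfile_of_le (by norm_num)]; ring

/-- `η̃` is smooth. [folklore] -/
theorem contDiff_expandProfile {n : ℕ∞} : ContDiff ℝ n expandProfile := by
  unfold expandProfile
  exact (contDiff_const.add (contDiff_id.div_const _)).add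
    (contDiff_neckCut.mul ((contDiff_const.mul contDiff_id).div_const _ |>.sub contDiff_const))

/-- The derivative of `η̃`. [folklore] -/
theorem hasDerivAt_expandProfile (t : ℝ) :
    HasDerivAt expandProfile (1 / 8 + (deriv neckCut t * (7 * t / 8 - 1 / 8) +
      neckCut t * (7 / 8))) t := by
  have hχ : HasDerivAt neckCut (deriv neckCut t) t := (differentiable_neckCut t).hasDerivAt
  have hL : HasDerivAt (fun t : ℝ => 7 * t / 8 - 1 / 8) (7 / 8) t := by
    have h1 := (((hasDerivAt_id' t).const_mul (7 : ℝ)).div_const 8).sub_const (1 / 8 : ℝ)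
    refine h1.congr_deriv ?_
    ring
  have h0 : HasDerivAt (fun t : ℝ => 1 / 8 + t / 8) (1 / 8) t := by
    simpa using ((hasDerivAt_id' t).div_const 8).const_add (1 / 8 : ℝ)
  have := h0.add (hχ.mul hL)
  exact this

/-- The derivative of `η̃` is at least `1/8`, in particular positive: on the support of `χ'`
the factor `7t/8 - 1/8` is nonnegative. [folklore] -/
theorem deriv_expandProfile_pos (t : ℝ) :
    0 < 1 / 8 + (deriv neckCut t * (7 * t / 8 - 1 / 8) + neckCut t * (7 / 8)) := by
  have hχ0 := neckCut_nonneg t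
  have hχ' := deriv_neckCut_nonneg t
  have hkey : 0 ≤ deriv neckCut t * (7 * t / 8 - 1 / 8) := by
    rcases lt_or_ge t (1 / 4) with h4 | h4
    · have : deriv neckCut t = 0 := by
        have hev : neckCut =ᶠ[𝓝 t] fun _ => 0 :=
          eventuallyEq_of_mem (Iio_mem_nhds h4) fun x hx => neckCut_of_le (le_of_lt hx)
        rw [hev.deriv_eq, deriv_const]
      rw [this, zero_mul]
    · exact mul_nonneg hχ' (by linarith)
  nlinarith

/-- `η̃` is strictly increasing. [folklore] -/
theorem strictMono_expandProfile : StrictMono expandProfile :=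
  strictMono_of_deriv_pos fun t => by
    rw [(hasDerivAt_expandProfile t).deriv]; exact deriv_expandProfile_pos t

/-- `η̃` is injective. [folklore] -/
theorem injective_expandProfile : Injective expandProfile := strictMono_expandProfile.injective

/-- `η̃ t > 1/8` for `t > 0`. [folklore] -/
theorem expandProfile_gt {t : ℝ} (h : 0 < t) : 1 / 8 < expandProfile t := by
  rw [← expandProfile_zero]; exact strictMono_expandProfile h

/-- `η̃ t > 0` for `t ≥ 0`. [folklore] -/
theorem expandProfile_pos {t : ℝ} (h : 0 ≤ t) : 0 < expandProfile t := by
  rcases h.lt_or_eq with h | h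
  · linarith [expandProfile_gt h]
  · rw [← h, expandProfile_zero]; norm_num

/-- For `η̃ t < 1` with `t ≥ 0` one has `t < 1`. [folklore] -/
theorem lt_one_of_expandProfile_lt_one {t : ℝ} (h : expandProfile t < 1) : t < 1 := by
  by_contra h1
  push Not at h1
  rw [expandProfile_of_ge (by linarith)] at h
  linarith

/-- `η̃` is continuous. [folklore] -/
theorem continuous_expandProfile : Continuous expandProfile :=
  (contDiff_expandProfile (n := 0)).continuous

/-- `η̃` maps `(0, ∞)` onto `(1/8, ∞)`. [folklore] -/
theorem exists_expandProfile_eq {s : ℝ} (hs : 1 / 8 < s) : ∃ t, 0 < t ∧ expandProfile t = s := by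
  rcases le_or_gt (3 / 4) s with h34 | h34
  · exact ⟨s, by linarith, expandProfile_of_ge h34⟩
  · have hc : ContinuousOn expandProfile (Icc 0 (3 / 4)) := continuous_expandProfile.continuousOn
    have hmem : s ∈ Icc (expandProfile 0) (expandProfile (3 / 4)) := by
      rw [expandProfile_zero, expandProfile_of_ge le_rfl]
      exact ⟨hs.le, h34.le⟩
    obtain ⟨t, ht, hts⟩ := intermediate_value_Icc (by norm_num : (0 : ℝ) ≤ 3 / 4) hc hmem
    refine ⟨t, ?_, hts⟩
    rcases ht.1.lt_or_eq with h0 | h0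
    · exact h0
    · rw [← h0, expandProfile_zero] at hts; linarith

/-- The inverse profile `η̃⁻¹`. [folklore] -/
def expandProfileInv : ℝ → ℝ := invFun expandProfile

/-- `η̃⁻¹ (η̃ t) = t`. [folklore] -/
theorem expandProfileInv_expandProfile (t : ℝ) : expandProfileInv (expandProfile t) = t :=
  leftInverse_invFun injective_expandProfile t

/-- `η̃⁻¹` is smooth at every `η̃ t` (inverse function theorem, `η̃' > 0`). [folklore] -/
theorem contDiffAt_expandProfileInv (t : ℝ) :
    ContDiffAt ℝ ∞ expandProfileInv (expandProfile t) :=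
  contDiffAt_leftInverse_of_hasDerivAt contDiff_expandProfile.contDiffAt (hasDerivAt_expandProfile t)
    (deriv_expandProfile_pos t).ne' (by simp) (leftInverse_invFun injective_expandProfile)

end ExpandProfile

/-! ### §2 The expansion of the punctured model space -/

section Expansion

variable {E : Type*} [NormedAddCommGroup E] [InnerProductSpace ℝ E]

/-- **The neck expansion** `radialMap η̃ : E ∖ 0 → E ∖ B̄(0, 1/8)`, `t • u ↦ η̃ t • u`; the identity
on `‖z‖ ≥ 3/4`. [folklore] -/
def neckExpansion : E → E := radialMap expandProfile

/-- The inverse of the neck expansion (on `‖y‖ > 1/8`). [folklore] -/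
def neckExpansionInv : E → E := radialMap expandProfileInv

/-- `‖neckExpansion z‖ = η̃ ‖z‖` for `z ≠ 0`. [folklore] -/
theorem norm_neckExpansion {z : E} (hz : z ≠ 0) : ‖neckExpansion z‖ = expandProfile ‖z‖ := by
  rw [neckExpansion, norm_radialMap _ hz, abs_of_pos (expandProfile_pos (norm_nonneg z))]

/-- `‖neckExpansion z‖ > 1/8` for `z ≠ 0`. [folklore] -/
theorem lt_norm_neckExpansion {z : E} (hz : z ≠ 0) : 8⁻¹ < ‖neckExpansion z‖ := by
  rw [norm_neckExpansion hz, ← one_div]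
  exact expandProfile_gt (norm_pos_iff.2 hz)

/-- `neckExpansion (t • u) = η̃ t • u` for a unit vector `u` and `t > 0`. [folklore] -/
theorem neckExpansion_smul {u : E} (hu : ‖u‖ = 1) {t : ℝ} (ht : 0 < t) :
    neckExpansion (t • u) = expandProfile t • u := radialMap_smul _ hu ht

/-- `neckExpansion z = z` for `‖z‖ ≥ 3/4`. [folklore] -/
theorem neckExpansion_eq_self {z : E} (hz : 3 / 4 ≤ ‖z‖) : neckExpansion z = z :=
  radialMap_eq_self _ (expandProfile_of_ge hz)

/-- `neckExpansionInv y = y` for `‖y‖ ≥ 3/4`. [folklore] -/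
theorem neckExpansionInv_eq_self {y : E} (hy : 3 / 4 ≤ ‖y‖) : neckExpansionInv y = y := by
  refine radialMap_eq_self _ ?_
  conv_lhs => rw [← expandProfile_of_ge hy]
  exact expandProfileInv_expandProfile _

/-- `neckExpansionInv (neckExpansion z) = z` for `z ≠ 0`. [folklore] -/
theorem neckExpansionInv_neckExpansion {z : E} (hz : z ≠ 0) :
    neckExpansionInv (neckExpansion z) = z := by
  rw [neckExpansionInv, neckExpansion,
    radialMap_radialMap _ _ hz (expandProfile_pos (norm_nonneg z)),
    expandProfileInv_expandProfile, mul_inv_cancel₀ (norm_ne_zero_iff.2 hz), one_smul]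

/-- `neckExpansion (neckExpansionInv y) = y` for `‖y‖ > 1/8`. [folklore] -/
theorem neckExpansion_neckExpansionInv {y : E} (hy : 8⁻¹ < ‖y‖) :
    neckExpansion (neckExpansionInv y) = y := by
  have hy0 : y ≠ 0 := by
    rintro rfl
    rw [norm_zero] at hy
    norm_num at hy
  obtain ⟨t, ht, hty⟩ := exists_expandProfile_eq (s := ‖y‖) (by rw [one_div]; exact hy)
  have hinv : expandProfileInv ‖y‖ = t := by rw [← hty, expandProfileInv_expandProfile]
  rw [neckExpansion, neckExpansionInv, radialMap_radialMap _ _ hy0 (by rw [hinv]; exact ht), hinv,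
    hty, mul_inv_cancel₀ (norm_ne_zero_iff.2 hy0), one_smul]

/-- `neckExpansionInv y ≠ 0` for `‖y‖ > 1/8`. [folklore] -/
theorem neckExpansionInv_ne_zero {y : E} (hy : 8⁻¹ < ‖y‖) : neckExpansionInv y ≠ 0 := by
  intro h
  have h' := congrArg (neckExpansion : E → E) h
  rw [neckExpansion_neckExpansionInv hy, neckExpansion, radialMap_zero] at h'
  rw [h', norm_zero] at hy
  norm_num at hy

/-- The neck expansion is smooth away from the origin. [folklore] -/
theorem contDiffAt_neckExpansion {z : E} (hz : z ≠ 0) : ContDiffAt ℝ ∞ (neckExpansion : E → E) z :=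
  contDiffAt_radialMap hz contDiff_expandProfile.contDiffAt

/-- The neck expansion is smooth on `E ∖ {0}`. [folklore] -/
theorem contDiffOn_neckExpansion : ContDiffOn ℝ ∞ (neckExpansion : E → E) {0}ᶜ := fun _ hz =>
  (contDiffAt_neckExpansion hz).contDiffWithinAt

/-- The inverse expansion is smooth at the points `‖y‖ > 1/8`. [folklore] -/
theorem contDiffAt_neckExpansionInv {y : E} (hy : 8⁻¹ < ‖y‖) :
    ContDiffAt ℝ ∞ (neckExpansionInv : E → E) y := by
  have hy0 : y ≠ 0 := by
    rintro rfl
    rw [norm_zero] at hy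
    norm_num at hy
  obtain ⟨t, -, hty⟩ := exists_expandProfile_eq (s := ‖y‖) (by rw [one_div]; exact hy)
  refine contDiffAt_radialMap hy0 ?_
  rw [← hty]
  exact contDiffAt_expandProfileInv t

/-- The inverse expansion is smooth on `E ∖ B̄(0, 1/8)`. [folklore] -/
theorem contDiffOn_neckExpansionInv :
    ContDiffOn ℝ ∞ (neckExpansionInv : E → E) (closedBall 0 8⁻¹)ᶜ := fun _ hy =>
  (contDiffAt_neckExpansionInv (by simpa using hy)).contDiffWithinAt

/-- The neck expansion as a partial homeomorphism `E ∖ 0 ≃ E ∖ B̄(0, 1/8)`, smooth with smooth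
inverse. [folklore] -/
def neckExpansionPartialHomeomorph : OpenPartialHomeomorph E E where
  toFun := neckExpansion
  invFun := neckExpansionInv
  source := {0}ᶜ
  target := (closedBall 0 8⁻¹)ᶜ
  map_source' _ hz := by simpa using lt_norm_neckExpansion hz
  map_target' _ hy := neckExpansionInv_ne_zero (by simpa using hy)
  left_inv' _ hz := neckExpansionInv_neckExpansion hz
  right_inv' _ hy := neckExpansion_neckExpansionInv (by simpa using hy)
  open_source := isOpen_compl_singleton
  open_target := isClosed_closedBall.isOpen_compl
  continuousOn_toFun := contDiffOn_neckExpansion.continuousOn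
  continuousOn_invFun := contDiffOn_neckExpansionInv.continuousOn

/-- `neckExpansionPartialHomeomorph` acts as `neckExpansion`. [folklore] -/
@[simp] theorem neckExpansionPartialHomeomorph_coe :
    ⇑(neckExpansionPartialHomeomorph : OpenPartialHomeomorph E E) = neckExpansion := rfl

/-- Its inverse acts as `neckExpansionInv`. [folklore] -/
@[simp] theorem neckExpansionPartialHomeomorph_symm_coe :
    ⇑(neckExpansionPartialHomeomorph : OpenPartialHomeomorph E E).symm = neckExpansionInv := rfl

/-- Its source is `E ∖ {0}`. [folklore] -/
@[simp] theorem neckExpansionPartialHomeomorph_source :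
    (neckExpansionPartialHomeomorph : OpenPartialHomeomorph E E).source = {0}ᶜ := rfl

/-- Its target is `E ∖ B̄(0, 1/8)`. [folklore] -/
@[simp] theorem neckExpansionPartialHomeomorph_target :
    (neckExpansionPartialHomeomorph : OpenPartialHomeomorph E E).target = (closedBall 0 8⁻¹)ᶜ := rfl

end Expansion

/-! ### §3 The squeeze profile and the squeeze of the model space -/

section Squeeze

/-- **The squeeze profile** `h s = ψ (4 s) / 8`: a smooth increasing map `[0, ∞) → [0, 1/8)`,
linear (`s/64`) on `[0, 2]`, tending to `1/8` at infinity like `1/8 - 1/(8 s)`. [folklore] -/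
def squeezeProfile (s : ℝ) : ℝ := ballProfile (4 * s) / 8

/-- `h s = s/64` for `s ≤ 2`. [folklore] -/
theorem squeezeProfile_of_le {s : ℝ} (h : s ≤ 2) : squeezeProfile s = s / 64 := by
  rw [squeezeProfile, ballProfile_of_le (by linarith)]; ring

/-- `h s = 1/8 - 1/(8 s)` for `s ≥ 4`. [folklore] -/
theorem squeezeProfile_of_ge {s : ℝ} (h : 4 ≤ s) : squeezeProfile s = 1 / 8 - 1 / (8 * s) := by
  have hs : s ≠ 0 := by linarith
  rw [squeezeProfile, ballProfile_of_ge (by linarith)]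
  field_simp

/-- `h 0 = 0`. [folklore] -/
theorem squeezeProfile_zero : squeezeProfile 0 = 0 := by
  rw [squeezeProfile_of_le (by norm_num)]; ring

/-- `0 < h s < 1/8` for `s > 0`. [folklore] -/
theorem squeezeProfile_mem_Ioo {s : ℝ} (h : 0 < s) : squeezeProfile s ∈ Ioo (0 : ℝ) (1 / 8) := by
  have := ballProfile_mem_Ioo (show 0 < 4 * s by linarith)
  constructor
  · unfold squeezeProfile; linarith [this.1]
  · unfold squeezeProfile; linarith [this.2]

/-- `h` is strictly increasing. [folklore] -/
theorem strictMono_squeezeProfile : StrictMono squeezeProfile := fun a b hab => by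
  unfold squeezeProfile
  have := strictMono_ballProfile (show 4 * a < 4 * b by linarith)
  linarith

/-- `h` is smooth away from `0` (and near `0`, where it is linear; see
`contDiff_neckSqueeze`). [folklore] -/
theorem contDiffAt_squeezeProfile {s : ℝ} (h : s ≠ 0) : ContDiffAt ℝ ∞ squeezeProfile s := by
  unfold squeezeProfile
  exact ((contDiffAt_ballProfile (by positivity : (4 : ℝ) * s ≠ 0)).comp s
    (contDiffAt_const.mul contDiffAt_id)).div_const _

variable {E : Type*} [NormedAddCommGroup E] [InnerProductSpace ℝ E]

/-- **The neck squeeze** `z ↦ 8⁻¹ • ballContraction (4 • z) : E → B(0, 1/8)`, i.e.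
`s • u ↦ h s • u`. [folklore] -/
def neckSqueeze (z : E) : E := (8⁻¹ : ℝ) • ballContraction ((4 : ℝ) • z)

/-- The inverse of the neck squeeze on `B(0, 1/8)`. [folklore] -/
def neckSqueezeInv (y : E) : E := (4⁻¹ : ℝ) • ballContractionInv ((8 : ℝ) • y)

/-- The neck squeeze is the radial map of the squeeze profile. [folklore] -/
theorem neckSqueeze_eq_radialMap (z : E) : neckSqueeze z = radialMap squeezeProfile z := by
  rcases eq_or_ne z 0 with rfl | hz
  · simp [neckSqueeze, radialMap_zero, ballContraction_zero]
  · have hzn : 0 < ‖z‖ := norm_pos_iff.2 hz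
    rw [neckSqueeze, ballContraction, radialMap, radialMap, norm_smul, Real.norm_of_nonneg
      (by norm_num : (0:ℝ) ≤ 4), smul_smul, smul_smul, squeezeProfile]
    congr 1
    field_simp

/-- `‖neckSqueeze z‖ = h ‖z‖`. [folklore] -/
theorem norm_neckSqueeze (z : E) : ‖neckSqueeze z‖ = squeezeProfile ‖z‖ := by
  rw [neckSqueeze, norm_smul, norm_ballContraction, norm_smul, Real.norm_of_nonneg
    (by norm_num : (0:ℝ) ≤ 4), Real.norm_of_nonneg (by norm_num : (0:ℝ) ≤ 8⁻¹), squeezeProfile]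
  ring

/-- `‖neckSqueeze z‖ < 1/8`. [folklore] -/
theorem norm_neckSqueeze_lt (z : E) : ‖neckSqueeze z‖ < 8⁻¹ := by
  rw [neckSqueeze, norm_smul, Real.norm_of_nonneg (by norm_num : (0:ℝ) ≤ 8⁻¹)]
  have := norm_ballContraction_lt_one ((4 : ℝ) • z)
  have h8 : (0 : ℝ) < 8⁻¹ := by norm_num
  calc 8⁻¹ * ‖ballContraction ((4 : ℝ) • z)‖ < 8⁻¹ * 1 := by gcongr
    _ = 8⁻¹ := by ring

/-- `neckSqueeze (s • u) = h s • u` for a unit vector `u` and `s > 0`. [folklore] -/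
theorem neckSqueeze_smul {u : E} (hu : ‖u‖ = 1) {s : ℝ} (hs : 0 < s) :
    neckSqueeze (s • u) = squeezeProfile s • u := by
  rw [neckSqueeze_eq_radialMap, radialMap_smul _ hu hs]

/-- The neck squeeze is `64⁻¹ • id` on `‖z‖ < 2`. [folklore] -/
theorem neckSqueeze_eq_smul_of_norm_lt {z : E} (hz : ‖z‖ < 2) : neckSqueeze z = (64⁻¹ : ℝ) • z := by
  rw [neckSqueeze_eq_radialMap]
  refine radialMap_eq_smul_of_norm_lt squeezeProfile (fun t _ ht => ?_) hz
  rw [squeezeProfile_of_le ht.le]; ring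

/-- `neckSqueeze 0 = 0`. [folklore] -/
theorem neckSqueeze_zero : neckSqueeze (0 : E) = 0 := by
  rw [neckSqueeze_eq_smul_of_norm_lt (by simp)]; simp

/-- **The neck squeeze is smooth** (everywhere). [folklore] -/
theorem contDiff_neckSqueeze : ContDiff ℝ ∞ (neckSqueeze : E → E) := by
  unfold neckSqueeze
  exact contDiff_const.smul (contDiff_ballContraction.comp (contDiff_const.smul contDiff_id))

/-- The neck squeeze is continuous. [folklore] -/
theorem continuous_neckSqueeze : Continuous (neckSqueeze : E → E) := contDiff_neckSqueeze.continuous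

/-- `neckSqueezeInv (neckSqueeze z) = z`. [folklore] -/
theorem neckSqueezeInv_neckSqueeze (z : E) : neckSqueezeInv (neckSqueeze z) = z := by
  rw [neckSqueezeInv, neckSqueeze, smul_smul, show ((8 : ℝ) * 8⁻¹) = 1 by norm_num, one_smul,
    ballContractionInv_ballContraction, smul_smul, show ((4⁻¹ : ℝ) * 4) = 1 by norm_num, one_smul]

/-- The neck squeeze is injective. [folklore] -/
theorem injective_neckSqueeze : Injective (neckSqueeze : E → E) :=
  HasLeftInverse.injective ⟨_, neckSqueezeInv_neckSqueeze⟩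

/-- `neckSqueeze (neckSqueezeInv y) = y` for `‖y‖ < 1/8`. [folklore] -/
theorem neckSqueeze_neckSqueezeInv {y : E} (hy : ‖y‖ < 8⁻¹) : neckSqueeze (neckSqueezeInv y) = y := by
  have h8 : ‖(8 : ℝ) • y‖ < 1 := by
    rw [norm_smul, Real.norm_of_nonneg (by norm_num : (0:ℝ) ≤ 8)]
    calc 8 * ‖y‖ < 8 * 8⁻¹ := by gcongr
      _ = 1 := by norm_num
  rw [neckSqueeze, neckSqueezeInv, smul_smul, show ((4 : ℝ) * 4⁻¹) = 1 by norm_num, one_smul,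
    ballContraction_ballContractionInv h8, smul_smul, show ((8⁻¹ : ℝ) * 8) = 1 by norm_num, one_smul]

/-- The range of the neck squeeze is the ball `B(0, 1/8)`. [folklore] -/
theorem range_neckSqueeze : range (neckSqueeze : E → E) = ball 0 8⁻¹ :=
  Subset.antisymm (by rintro _ ⟨z, rfl⟩; simpa using norm_neckSqueeze_lt z) fun y hy =>
    ⟨neckSqueezeInv y, neckSqueeze_neckSqueezeInv (by simpa using hy)⟩

/-- The inverse squeeze is smooth on the ball `B(0, 1/8)`. [folklore] -/
theorem contDiffAt_neckSqueezeInv {y : E} (hy : ‖y‖ < 8⁻¹) :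
    ContDiffAt ℝ ∞ (neckSqueezeInv : E → E) y := by
  have h8 : ‖(8 : ℝ) • y‖ < 1 := by
    rw [norm_smul, Real.norm_of_nonneg (by norm_num : (0:ℝ) ≤ 8)]
    calc 8 * ‖y‖ < 8 * 8⁻¹ := by gcongr
      _ = 1 := by norm_num
  unfold neckSqueezeInv
  exact contDiffAt_const.smul ((contDiffAt_ballContractionInv h8).comp y
    (contDiffAt_const.smul contDiffAt_id))

/-- The inverse squeeze is smooth on `B(0, 1/8)` (set form). [folklore] -/
theorem contDiffOn_neckSqueezeInv : ContDiffOn ℝ ∞ (neckSqueezeInv : E → E) (ball 0 8⁻¹) :=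
  fun _ hy => (contDiffAt_neckSqueezeInv (by simpa using hy)).contDiffWithinAt

/-- The neck squeeze as a partial homeomorphism `E ≃ B(0, 1/8)`, smooth with smooth inverse.
[folklore] -/
def neckSqueezePartialHomeomorph : OpenPartialHomeomorph E E where
  toFun := neckSqueeze
  invFun := neckSqueezeInv
  source := univ
  target := ball 0 8⁻¹
  map_source' z _ := by simpa using norm_neckSqueeze_lt z
  map_target' _ _ := mem_univ _
  left_inv' z _ := neckSqueezeInv_neckSqueeze z
  right_inv' _ hy := neckSqueeze_neckSqueezeInv (by simpa using hy)
  open_source := isOpen_univ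
  open_target := isOpen_ball
  continuousOn_toFun := continuous_neckSqueeze.continuousOn
  continuousOn_invFun := contDiffOn_neckSqueezeInv.continuousOn

/-- `neckSqueezePartialHomeomorph` acts as `neckSqueeze`. [folklore] -/
@[simp] theorem neckSqueezePartialHomeomorph_coe :
    ⇑(neckSqueezePartialHomeomorph : OpenPartialHomeomorph E E) = neckSqueeze := rfl

/-- Its inverse acts as `neckSqueezeInv`. [folklore] -/
@[simp] theorem neckSqueezePartialHomeomorph_symm_coe :
    ⇑(neckSqueezePartialHomeomorph : OpenPartialHomeomorph E E).symm = neckSqueezeInv := rfl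

/-- Its source is everything. [folklore] -/
@[simp] theorem neckSqueezePartialHomeomorph_source :
    (neckSqueezePartialHomeomorph : OpenPartialHomeomorph E E).source = univ := rfl

/-- Its target is the ball `B(0, 1/8)`. [folklore] -/
@[simp] theorem neckSqueezePartialHomeomorph_target :
    (neckSqueezePartialHomeomorph : OpenPartialHomeomorph E E).target = ball 0 8⁻¹ := rfl

end Squeeze

/-! ### §4 The neck profile -/

section NeckProfile

/-- **The neck profile** `γ t = h (-1/t) = ψ (-4/t) / 8` for `t < 0`, `γ t = η̃ t` for `t ≥ 0`:
the radius, in the blown-up disc, of the point at height `t` of the neck. [folklore] -/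
def neckProfile (t : ℝ) : ℝ := if t < 0 then squeezeProfile (-t⁻¹) else expandProfile t

/-- `γ t = η̃ t` for `t ≥ 0`. [folklore] -/
theorem neckProfile_of_nonneg {t : ℝ} (h : 0 ≤ t) : neckProfile t = expandProfile t := by
  rw [neckProfile, if_neg (not_lt.2 h)]

/-- `γ t = h (-1/t)` for `t < 0`. [folklore] -/
theorem neckProfile_of_neg {t : ℝ} (h : t < 0) : neckProfile t = squeezeProfile (-t⁻¹) := by
  rw [neckProfile, if_pos h]

/-- **First matching**: `γ (-t) = h (1/t)` for `t > 0` (the squeezed second summand). [folklore] -/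
theorem neckProfile_neg {t : ℝ} (h : 0 < t) : neckProfile (-t) = squeezeProfile t⁻¹ := by
  rw [neckProfile_of_neg (by linarith), inv_neg, neg_neg]

/-- **Second matching**: `γ t = η̃ t` for `t > 0` (the expanded first summand). [folklore] -/
theorem neckProfile_of_pos {t : ℝ} (h : 0 < t) : neckProfile t = expandProfile t :=
  neckProfile_of_nonneg h.le

/-- `γ t = t` for `t ≥ 3/4`. [folklore] -/
theorem neckProfile_of_ge {t : ℝ} (h : 3 / 4 ≤ t) : neckProfile t = t := by
  rw [neckProfile_of_nonneg (by linarith), expandProfile_of_ge h]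

/-- For `-1/4 ≤ t < 0` one has `-1/t ≥ 4`. [folklore] -/
theorem four_le_neg_inv {t : ℝ} (h1 : -(1 / 4) ≤ t) (h2 : t < 0) : 4 ≤ -t⁻¹ := by
  rw [← inv_neg]
  exact (le_inv_comm₀ (by norm_num : (0 : ℝ) < 4) (by linarith : 0 < -t)).2 (by linarith)

/-- **`γ` is affine through `0`**: `γ t = 1/8 + t/8` on `[-1/4, 1/4]` (for `t < 0` because
`ψ ρ = 1 - 4/ρ` at `ρ = -4/t ≥ 16`). [folklore] -/
theorem neckProfile_of_abs_le {t : ℝ} (h : |t| ≤ 1 / 4) : neckProfile t = 1 / 8 + t / 8 := by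
  rw [abs_le] at h
  rcases lt_or_ge t 0 with ht | ht
  · rw [neckProfile_of_neg ht, squeezeProfile_of_ge (four_le_neg_inv h.1 ht)]
    have : t ≠ 0 := ht.ne
    field_simp
    ring
  · rw [neckProfile_of_nonneg ht, expandProfile_of_le h.2]

/-- `γ 0 = 1/8`. [folklore] -/
theorem neckProfile_zero : neckProfile 0 = 1 / 8 := by
  rw [neckProfile_of_abs_le (by norm_num)]; ring

/-- `γ t > 0`. [folklore] -/
theorem neckProfile_pos (t : ℝ) : 0 < neckProfile t := by
  rcases lt_or_ge t 0 with ht | ht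
  · rw [neckProfile_of_neg ht]
    exact (squeezeProfile_mem_Ioo (by rw [← inv_neg]; exact inv_pos.2 (by linarith))).1
  · rw [neckProfile_of_nonneg ht]; exact expandProfile_pos ht

/-- `γ t < 1/8` for `t < 0`. [folklore] -/
theorem neckProfile_lt_of_neg {t : ℝ} (ht : t < 0) : neckProfile t < 1 / 8 := by
  rw [neckProfile_of_neg ht]
  exact (squeezeProfile_mem_Ioo (by rw [← inv_neg]; exact inv_pos.2 (by linarith))).2

/-- `γ t > 1/8` for `t > 0`. [folklore] -/
theorem neckProfile_gt_of_pos {t : ℝ} (ht : 0 < t) : 1 / 8 < neckProfile t := by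
  rw [neckProfile_of_pos ht]; exact expandProfile_gt ht

/-- **`γ` is smooth.** [folklore] -/
theorem contDiffAt_neckProfile (t : ℝ) : ContDiffAt ℝ ∞ neckProfile t := by
  rcases lt_trichotomy t 0 with ht | rfl | ht
  · have hev : neckProfile =ᶠ[𝓝 t] fun t => squeezeProfile (-t⁻¹) :=
      eventuallyEq_of_mem (Iio_mem_nhds ht) fun x hx => neckProfile_of_neg hx
    refine ContDiffAt.congr_of_eventuallyEq ?_ hev
    have h0 : -t⁻¹ ≠ 0 := by rw [← inv_neg]; exact inv_ne_zero (by linarith)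
    exact (contDiffAt_squeezeProfile h0).comp t (contDiffAt_inv ℝ ht.ne).neg
  · have hev : neckProfile =ᶠ[𝓝 0] fun t => 1 / 8 + t / 8 := by
      have hmem : Ioo (-(1 / 4) : ℝ) (1 / 4) ∈ 𝓝 (0 : ℝ) := Ioo_mem_nhds (by norm_num) (by norm_num)
      exact eventuallyEq_of_mem hmem fun x hx => neckProfile_of_abs_le (abs_le.2 ⟨hx.1.le, hx.2.le⟩)
    refine ContDiffAt.congr_of_eventuallyEq ?_ hev
    exact (contDiffAt_const.add (contDiffAt_id.div_const _))
  · have hev : neckProfile =ᶠ[𝓝 t] expandProfile :=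
      eventuallyEq_of_mem (Ioi_mem_nhds ht) fun x hx => neckProfile_of_pos hx
    exact contDiff_expandProfile.contDiffAt.congr_of_eventuallyEq hev

/-- `γ` is smooth (global form). [folklore] -/
theorem contDiff_neckProfile : ContDiff ℝ ∞ neckProfile :=
  contDiff_iff_contDiffAt.2 contDiffAt_neckProfile

/-- `γ` is continuous. [folklore] -/
theorem continuous_neckProfile : Continuous neckProfile := contDiff_neckProfile.continuous

/-- The derivative of the squeezed branch `t ↦ h (-1/t)` at `t < 0` is positive. [folklore] -/
theorem exists_hasDerivAt_squeeze_branch {t : ℝ} (ht : t < 0) :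
    ∃ d, 0 < d ∧ HasDerivAt (fun t : ℝ => squeezeProfile (-t⁻¹)) d t := by
  have hs : 0 < -t⁻¹ := by rw [← inv_neg]; exact inv_pos.2 (by linarith)
  have h4 : (4 : ℝ) * -t⁻¹ ≠ 0 := by positivity
  -- `t ↦ -t⁻¹` has derivative `t⁻²`
  have hq : HasDerivAt (fun t : ℝ => -t⁻¹) (t ^ 2)⁻¹ t := by
    have := (hasDerivAt_inv ht.ne).neg
    refine this.congr_deriv ?_
    field_simp
  -- `s ↦ ψ (4 s) / 8`
  have hψ : HasDerivAt squeezeProfile ((1 / 32 + (deriv transitionCut (4 * -t⁻¹) *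
      (1 - 4 / (4 * -t⁻¹) - 4 * -t⁻¹ / 32) + transitionCut (4 * -t⁻¹) *
      (4 / (4 * -t⁻¹) ^ 2 - 1 / 32))) * 4 / 8) (-t⁻¹) := by
    unfold squeezeProfile
    have h1 := (hasDerivAt_ballProfile h4).comp (-t⁻¹)
      ((hasDerivAt_id' (-t⁻¹)).const_mul (4 : ℝ))
    have h2 := h1.div_const 8
    refine h2.congr_deriv ?_
    simp only [mul_one]
  have hc := hψ.comp t hq
  rw [Function.comp_def] at hc
  refine ⟨_, ?_, hc⟩
  have ht2 : 0 < (t ^ 2)⁻¹ := inv_pos.2 (by nlinarith)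
  refine mul_pos ?_ ht2
  have := deriv_ballProfile_pos (show 0 < 4 * -t⁻¹ by positivity)
  positivity

/-- **`γ` has a positive derivative everywhere.** [folklore] -/
theorem exists_hasDerivAt_neckProfile (t : ℝ) : ∃ d, 0 < d ∧ HasDerivAt neckProfile d t := by
  rcases lt_trichotomy t 0 with ht | rfl | ht
  · have hev : neckProfile =ᶠ[𝓝 t] fun t => squeezeProfile (-t⁻¹) :=
      eventuallyEq_of_mem (Iio_mem_nhds ht) fun x hx => neckProfile_of_neg hx
    obtain ⟨d, hd, h⟩ := exists_hasDerivAt_squeeze_branch ht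
    exact ⟨d, hd, h.congr_of_eventuallyEq hev⟩
  · have hev : neckProfile =ᶠ[𝓝 0] fun t => 1 / 8 + t / 8 := by
      have hmem : Ioo (-(1 / 4) : ℝ) (1 / 4) ∈ 𝓝 (0 : ℝ) := Ioo_mem_nhds (by norm_num) (by norm_num)
      exact eventuallyEq_of_mem hmem fun x hx => neckProfile_of_abs_le (abs_le.2 ⟨hx.1.le, hx.2.le⟩)
    refine ⟨1 / 8, by norm_num, ?_⟩
    have h : HasDerivAt (fun t : ℝ => 1 / 8 + t / 8) (1 / 8) 0 := by
      simpa using ((hasDerivAt_id' (0 : ℝ)).div_const 8).const_add (1 / 8 : ℝ)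
    exact h.congr_of_eventuallyEq hev
  · have hev : neckProfile =ᶠ[𝓝 t] expandProfile :=
      eventuallyEq_of_mem (Ioi_mem_nhds ht) fun x hx => neckProfile_of_pos hx
    exact ⟨_, deriv_expandProfile_pos t, (hasDerivAt_expandProfile t).congr_of_eventuallyEq hev⟩

/-- `γ' > 0` (`deriv` form). [folklore] -/
theorem deriv_neckProfile_pos (t : ℝ) : 0 < deriv neckProfile t := by
  obtain ⟨d, hd, h⟩ := exists_hasDerivAt_neckProfile t
  rwa [h.deriv]

/-- **`γ` is strictly increasing.** [folklore] -/
theorem strictMono_neckProfile : StrictMono neckProfile := strictMono_of_deriv_pos deriv_neckProfile_pos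

/-- `γ` is injective. [folklore] -/
theorem injective_neckProfile : Injective neckProfile := strictMono_neckProfile.injective

/-- **`γ` maps `ℝ` onto `(0, ∞)`.** [folklore] -/
theorem exists_neckProfile_eq {r : ℝ} (hr : 0 < r) : ∃ t, neckProfile t = r := by
  rcases lt_trichotomy r (1 / 8) with h | rfl | h
  · -- `r = h s` with `s > 0`, `t = -1/s`
    obtain ⟨ρ, hρ, hρr⟩ := exists_ballProfile_eq (s := 8 * r) ⟨by linarith, by linarith⟩
    refine ⟨-(ρ / 4)⁻¹, ?_⟩
    have hs : 0 < ρ / 4 := by positivity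
    rw [neckProfile_of_neg (by rw [neg_lt_zero]; exact inv_pos.2 hs), inv_neg, neg_neg, inv_inv,
      squeezeProfile]
    rw [show 4 * (ρ / 4) = ρ by ring, hρr]
    ring
  · exact ⟨0, neckProfile_zero⟩
  · obtain ⟨t, ht, htr⟩ := exists_expandProfile_eq h
    exact ⟨t, by rw [neckProfile_of_pos ht, htr]⟩

/-- The range of `γ` is `(0, ∞)`. [folklore] -/
theorem range_neckProfile : range neckProfile = Ioi 0 :=
  Subset.antisymm (by rintro _ ⟨t, rfl⟩; exact neckProfile_pos t) fun _ hr => exists_neckProfile_eq hr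

/-- The inverse profile `γ⁻¹`. [folklore] -/
def neckProfileInv : ℝ → ℝ := invFun neckProfile

/-- `γ⁻¹ (γ t) = t`. [folklore] -/
theorem neckProfileInv_neckProfile (t : ℝ) : neckProfileInv (neckProfile t) = t :=
  leftInverse_invFun injective_neckProfile t

/-- `γ (γ⁻¹ r) = r` for `r > 0`. [folklore] -/
theorem neckProfile_neckProfileInv {r : ℝ} (hr : 0 < r) : neckProfile (neckProfileInv r) = r := by
  obtain ⟨t, rfl⟩ := exists_neckProfile_eq hr
  rw [neckProfileInv_neckProfile]

/-- **`γ⁻¹` is smooth** at every `γ t` (inverse function theorem, `γ' > 0`). [folklore] -/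
theorem contDiffAt_neckProfileInv (t : ℝ) : ContDiffAt ℝ ∞ neckProfileInv (neckProfile t) := by
  obtain ⟨d, hd, h⟩ := exists_hasDerivAt_neckProfile t
  exact contDiffAt_leftInverse_of_hasDerivAt (contDiffAt_neckProfile t) h hd.ne' (by simp)
    (leftInverse_invFun injective_neckProfile)

/-- `γ⁻¹` is smooth on `(0, ∞)`. [folklore] -/
theorem contDiffAt_neckProfileInv_of_pos {r : ℝ} (hr : 0 < r) : ContDiffAt ℝ ∞ neckProfileInv r := by
  obtain ⟨t, rfl⟩ := exists_neckProfile_eq hr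
  exact contDiffAt_neckProfileInv t

end NeckProfile

end Literature.Topology.FourManifolds
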